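import Literature.AlgebraicGeometry.Resolution.RegularSystemOfParameters
import Mathlib.RingTheory.Length
import Mathlib.RingTheory.SimpleModule.Basic
import Mathlib.Data.Finsupp.Multiset
import Mathlib.Data.Sym.Card
import HarnessLib

/-!
# The Hilbert function of a regular local ring: `ℓ(𝔪ⁿ/𝔪ⁿ⁺¹) = binom(n+d-1, n)`
# (Cossart–Jannsen–Saito 2020, Lemma 2.23, the case of equality)

Topic: `Literature/RingTheory/HilbertSamuel`. CJS Lemma 2.23: "Let `𝒪` be a noetherian local
ring of dimension `d` … Then `H^{(0)}_𝒪 ≥ Φ^{(d)}`, and equality holds if and only if `𝒪` is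
regular", whose proof is "`𝒪` is regular if and only if `gr_𝔪 𝒪 ≅ k[X_1, …, X_d]`" plus
Lemma 2.14. This file PROVES the half that the tree can carry today, in the invariant form of
lengths: for a REGULAR local ring `(R, 𝔪, k)` with `d = emb dim R` (`= dim R`),

  `ℓ_R(𝔪ⁿ/𝔪ⁿ⁺¹) = binom(n + d - 1, n) = Φ^{(d)}(n)`   (`length_gradedPiece_of_isRegularLocalRing`),

i.e. `H^{(0)}_R = Φ^{(d)}` (`HilbertFunctions.lean`: `iterPSum_Phi_eq_choose`; `LocalRing.lean`:
`length_gradedPiece_eq_hilbertFun`). Ingredients: a regular system of parameters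
`x_1, …, x_d` is quasi-regular (Matsumura Thm. 17.10 via Rees' Thm. 16.2,
`coeff_mem_maximalIdeal_of_eval_mem_pow`, `RegularSystemOfParameters.lean`), so the `R`-linear
map from the free module on the monomials of degree `n` to `𝔪ⁿ/𝔪ⁿ⁺¹`, `e_m ↦ x^m`, is onto with
kernel `{c | all c_m ∈ 𝔪}` — the same kernel as the reduction map onto the free `k`-module on
these monomials; and the monomials of degree `n` in `d` variables are counted by stars and bars
(`Sym.card_sym_eq_choose`).

## Content

* `evalMonomials x n` — the `R`-linear map `({m : |m| = n} →₀ R) → R`, `c ↦ Σ_m c_m x^m`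
  (`= eval x` of the form `Σ_m c_m X^m`, `evalMonomials_eq_eval_toForm`); its values lie in `𝔪ⁿ`
  and it maps ONTO `𝔪ⁿ = (x)ⁿ` (`range_evalMonomials`).
* `mem_ker_toGradedPiece_iff` — for a regular s.o.p.: `Σ_m c_m x^m ∈ 𝔪ⁿ⁺¹ ⟺ ∀ m, c_m ∈ 𝔪`.
* `gradedPieceEquivFinsuppQuotient` — `𝔪ⁿ/𝔪ⁿ⁺¹ ≃ₗ[R] ({m : |m| = n} →₀ k)`.
* `card_monomialsOfDegree` — `#{m : Fin d →₀ ℕ | |m| = n} = binom(d + n - 1, n)`.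
* `length_gradedPiece_of_isRegularLocalRing` — the theorem, with `d = (maximalIdeal R).spanFinrank`.

## Sources

* V. Cossart, U. Jannsen, S. Saito, LNM 2270 (2020), Lemma 2.23 (with Def. 2.13:
  `Φ^{(t)}(n) = H^{(0)}(k[X_1,…,X_t])(n) = binom(n+t-1, n)`). [CossartJannsenSaito2020]
* H. Matsumura, *Commutative Ring Theory* (1986), Thm. 17.10. [Matsumura1987]
-/

noncomputable section

open IsLocalRing MvPolynomial Finsupp

namespace Literature.RingTheory.HilbertSamuel

open Literature.AlgebraicGeometry.Resolution

universe u

variable {R : Type u} [CommRing R]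

/-! ## Monomials of a fixed degree and their evaluation -/

/-- The exponents of the monomials of degree `n` in `d` variables. [folklore] -/
abbrev monomialsOfDegree (d n : ℕ) : Type := {m : Fin d →₀ ℕ // degree m = n}

/-- **Stars and bars**: there are `binom(d + n - 1, n)` monomials of degree `n` in `d` variables
(exponent vectors of degree `n` are the multisets of size `n`, `Sym (Fin d) n`). [folklore] -/
theorem card_monomialsOfDegree (d n : ℕ) :
    Nat.card (monomialsOfDegree d n) = (d + n - 1).choose n := by
  classical
  let e : monomialsOfDegree d n ≃ Sym (Fin d) n :=
    Equiv.subtypeEquiv Multiset.toFinsupp.symm.toEquiv fun m => by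
      change degree m = n ↔ Multiset.card (Multiset.toFinsupp.symm m) = n
      rw [Multiset.toFinsupp_symm_apply, Finsupp.card_toMultiset]
      rfl
  rw [Nat.card_congr e, Nat.card_eq_fintype_card, Sym.card_sym_eq_choose, Fintype.card_fin]

/-- The monomials of a fixed degree form a finite type. [folklore] -/
instance (d n : ℕ) : Finite (monomialsOfDegree d n) := by
  classical
  exact Finite.of_equiv (Sym (Fin d) n) (Equiv.subtypeEquiv Multiset.toFinsupp.symm.toEquiv
    fun m => by
      change degree m = n ↔ Multiset.card (Multiset.toFinsupp.symm m) = n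
      rw [Multiset.toFinsupp_symm_apply, Finsupp.card_toMultiset]
      rfl).symm

variable {d : ℕ} (x : Fin d → R) (n : ℕ)

/-- The form `Σ_m c_m X^m ∈ R[X_1, …, X_d]` with prescribed coefficients on the monomials of
degree `n`. [folklore] -/
def toForm : (monomialsOfDegree d n →₀ R) →ₗ[R] MvPolynomial (Fin d) R :=
  Finsupp.linearCombination R fun m => monomial m.1 (1 : R)

/-- Unfolding `toForm`. [folklore] -/
theorem toForm_apply (c : monomialsOfDegree d n →₀ R) :
    toForm n c = c.sum fun m r => monomial m.1 r := by
  rw [toForm, Finsupp.linearCombination_apply]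
  congr 1
  funext m r
  rw [smul_monomial, smul_eq_mul, mul_one]

/-- The coefficients of `toForm c` are the `c_m`. [folklore] -/
theorem coeff_toForm (c : monomialsOfDegree d n →₀ R) (m : monomialsOfDegree d n) :
    coeff m.1 (toForm n c) = c m := by
  classical
  rw [toForm_apply, Finsupp.sum, coeff_sum]
  simp_rw [coeff_monomial]
  rw [Finset.sum_eq_single m]
  · simp
  · intro m' _ hm'
    rw [if_neg]
    exact fun h => hm' (Subtype.ext h)
  · intro hm
    simp [Finsupp.notMem_support_iff.mp hm]

/-- `toForm c` is a form of degree `n`. [folklore] -/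
theorem isHomogeneous_toForm (c : monomialsOfDegree d n →₀ R) : (toForm n c).IsHomogeneous n := by
  rw [toForm_apply, Finsupp.sum]
  exact IsHomogeneous.sum _ _ _ fun m _ => isHomogeneous_monomial _ m.2

/-- Evaluation of the monomials of degree `n` at `x`: `c ↦ Σ_m c_m x^m`. [folklore] -/
def evalMonomials : (monomialsOfDegree d n →₀ R) →ₗ[R] R :=
  Finsupp.linearCombination R fun m => ∏ i, x i ^ m.1 i

/-- `Σ_m c_m x^m` is the value at `x` of the form `Σ_m c_m X^m`. [folklore] -/
theorem evalMonomials_eq_eval_toForm (c : monomialsOfDegree d n →₀ R) :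
    evalMonomials x n c = eval x (toForm n c) := by
  rw [evalMonomials, Finsupp.linearCombination_apply, toForm_apply, Finsupp.sum,
    Finsupp.sum, map_sum]
  refine Finset.sum_congr rfl fun m _ => ?_
  rw [eval_monomial, Finsupp.prod_fintype _ _ fun i => pow_zero _, smul_eq_mul]

/-- A monomial of degree `n` in elements of an ideal `I` lies in `Iⁿ`. [folklore] -/
theorem prod_pow_mem_pow {I : Ideal R} (hx : ∀ i, x i ∈ I) (m : monomialsOfDegree d n) :
    ∏ i, x i ^ m.1 i ∈ I ^ n := by
  have h : ∏ i, x i ^ m.1 i ∈ ∏ i, I ^ m.1 i :=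
    Ideal.prod_mem_prod fun i _ => Ideal.pow_mem_pow (hx i) _
  rwa [Finset.prod_pow_eq_pow_sum, ← degree_eq_sum, m.2] at h

/-- The values `Σ_m c_m x^m` lie in `Iⁿ` when all `x_i ∈ I`. [folklore] -/
theorem evalMonomials_mem_pow {I : Ideal R} (hx : ∀ i, x i ∈ I) (c : monomialsOfDegree d n →₀ R) :
    evalMonomials x n c ∈ I ^ n := by
  rw [evalMonomials, Finsupp.linearCombination_apply, Finsupp.sum]
  exact Submodule.sum_mem _ fun m _ => Ideal.mul_mem_left _ _ (prod_pow_mem_pow x n hx m)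

/-- If moreover all coefficients lie in `I`, then `Σ_m c_m x^m ∈ Iⁿ⁺¹`. [folklore] -/
theorem evalMonomials_mem_pow_succ {I : Ideal R} (hx : ∀ i, x i ∈ I)
    (c : monomialsOfDegree d n →₀ R) (hc : ∀ m, c m ∈ I) : evalMonomials x n c ∈ I ^ (n + 1) := by
  rw [evalMonomials, Finsupp.linearCombination_apply, Finsupp.sum, pow_succ']
  exact Submodule.sum_mem _ fun m _ => Ideal.mul_mem_mul (hc m) (prod_pow_mem_pow x n hx m)

/-- **The monomials of degree `n` in generators of `I` span `Iⁿ`**: every element of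
`(x_1, …, x_d)ⁿ` is `Σ_m c_m x^m` (it is `F(x)` for a form `F` of degree `n`). [folklore] -/
theorem exists_evalMonomials_eq {y : R} (hy : y ∈ Ideal.span (Set.range x) ^ n) :
    ∃ c : monomialsOfDegree d n →₀ R, evalMonomials x n c = y := by
  obtain ⟨F, hF, rfl⟩ := exists_isHomogeneous_of_mem_span_pow x n hy
  refine ⟨Finsupp.subtypeDomain (fun m => degree m = n) (AddMonoidAlgebra.coeff F), ?_⟩
  have hsupp : ∀ m ∈ (AddMonoidAlgebra.coeff F).support, degree m = n := by
    intro m hm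
    by_contra hne
    exact (MvPolynomial.mem_support_iff.mp hm) (hF.coeff_eq_zero hne)
  rw [evalMonomials, Finsupp.linearCombination_apply,
    Finsupp.sum_subtypeDomain_index (v := AddMonoidAlgebra.coeff F)
      (h := fun m r => r • ∏ i, x i ^ m i) hsupp,
    MvPolynomial.sum_def, eval_eq']
  rfl

/-! ## The graded pieces of a regular local ring -/

section Regular

variable [IsRegularLocalRing R] (hd : (maximalIdeal R).spanFinrank = d)
  (hx : Ideal.span (Set.range x) = maximalIdeal R)

/-- The map `c ↦ Σ_m c_m x^m mod 𝔪ⁿ⁺¹` from the free module on the monomials of degree `n` to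
`𝔪ⁿ/𝔪ⁿ⁺¹`. [folklore] -/
def toGradedPiece (hx : Ideal.span (Set.range x) = maximalIdeal R) :
    (monomialsOfDegree d n →₀ R) →ₗ[R]
      ↥(maximalIdeal R ^ n) ⧸ (maximalIdeal R • ⊤ : Submodule R ↥(maximalIdeal R ^ n)) :=
  (maximalIdeal R • ⊤ : Submodule R ↥(maximalIdeal R ^ n)).mkQ ∘ₗ
    LinearMap.codRestrict (maximalIdeal R ^ n) (evalMonomials x n)
      (evalMonomials_mem_pow x n (mem_maximalIdeal_of_rsop x hx))

include hd in
/-- **Quasi-regularity, kernel form**: for a regular system of parameters `x` of a regular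
local ring, `Σ_m c_m x^m ≡ 0 mod 𝔪ⁿ⁺¹` iff all `c_m ∈ 𝔪` (Matsumura Thm. 17.10).
[cite: Matsumura1987, Thm. 17.10] -/
theorem mem_ker_toGradedPiece_iff (c : monomialsOfDegree d n →₀ R) :
    c ∈ LinearMap.ker (toGradedPiece x n hx) ↔ ∀ m, c m ∈ maximalIdeal R := by
  have hmx := mem_maximalIdeal_of_rsop x hx
  have hmap : Submodule.map (maximalIdeal R ^ n).subtype
      (maximalIdeal R • ⊤ : Submodule R ↥(maximalIdeal R ^ n)) = maximalIdeal R ^ (n + 1) := by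
    rw [Submodule.map_smul'', Submodule.map_top, Submodule.range_subtype, pow_succ']
    rfl
  have hker : c ∈ LinearMap.ker (toGradedPiece x n hx) ↔
      evalMonomials x n c ∈ maximalIdeal R ^ (n + 1) := by
    rw [LinearMap.mem_ker, toGradedPiece, LinearMap.comp_apply, Submodule.mkQ_apply,
      Submodule.Quotient.mk_eq_zero, ← hmap]
    constructor
    · intro h
      exact ⟨_, h, rfl⟩
    · rintro ⟨y, hy, hyc⟩
      have : y = LinearMap.codRestrict (maximalIdeal R ^ n) (evalMonomials x n)
          (evalMonomials_mem_pow x n hmx) c := Subtype.ext hyc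
      rwa [this] at hy
  rw [hker]
  constructor
  · intro h m
    rw [evalMonomials_eq_eval_toForm] at h
    have := coeff_mem_maximalIdeal_of_eval_mem_pow hd x hx (isHomogeneous_toForm n c) h m.1
    rwa [coeff_toForm] at this
  · exact evalMonomials_mem_pow_succ x n hmx c

include hx in
/-- The map onto `𝔪ⁿ/𝔪ⁿ⁺¹` is surjective (`𝔪ⁿ = (x)ⁿ` is spanned by the monomials). [folklore] -/
theorem toGradedPiece_surjective : Function.Surjective (toGradedPiece x n hx) := by
  intro q
  obtain ⟨⟨y, hy⟩, rfl⟩ := Submodule.mkQ_surjective _ q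
  have hy' : y ∈ Ideal.span (Set.range x) ^ n := by rwa [hx]
  obtain ⟨c, hc⟩ := exists_evalMonomials_eq x n hy'
  refine ⟨c, ?_⟩
  rw [toGradedPiece, LinearMap.comp_apply]
  congr 1
  exact Subtype.ext hc

/-- Reduction of coefficients modulo `𝔪`: `({m} →₀ R) → ({m} →₀ k)`. [folklore] -/
def reduceCoeffs : (monomialsOfDegree d n →₀ R) →ₗ[R]
    (monomialsOfDegree d n →₀ R ⧸ maximalIdeal R) :=
  Finsupp.mapRange.linearMap (maximalIdeal R).mkQ

/-- The kernel of the reduction of coefficients: all `c_m ∈ 𝔪`. [folklore] -/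
theorem mem_ker_reduceCoeffs_iff (c : monomialsOfDegree d n →₀ R) :
    c ∈ LinearMap.ker (reduceCoeffs (R := R) n) ↔ ∀ m, c m ∈ maximalIdeal R := by
  rw [LinearMap.mem_ker, reduceCoeffs, Finsupp.mapRange.linearMap_apply, Finsupp.ext_iff]
  refine forall_congr' fun m => ?_
  rw [Finsupp.mapRange_apply, Finsupp.zero_apply]
  exact Submodule.Quotient.mk_eq_zero _

/-- The reduction of coefficients is surjective. [folklore] -/
theorem reduceCoeffs_surjective : Function.Surjective (reduceCoeffs (R := R) (d := d) n) :=
  Finsupp.mapRange_surjective _ (map_zero _) (Submodule.mkQ_surjective _)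

/-- **`gr^n_𝔪(R)` of a regular local ring is the free `k`-module on the monomials of degree `n`
in a regular system of parameters** (Matsumura Thm. 17.10: `gr_𝔪(R) ≅ k[X_1, …, X_d]`), as an
`R`-linear isomorphism `𝔪ⁿ/𝔪ⁿ⁺¹ ≃ ({m : |m| = n} →₀ R/𝔪)`. [cite: Matsumura1987, Thm. 17.10] -/
def gradedPieceEquivFinsuppQuotient (hd : (maximalIdeal R).spanFinrank = d)
    (hx : Ideal.span (Set.range x) = maximalIdeal R) :
    (↥(maximalIdeal R ^ n) ⧸ (maximalIdeal R • ⊤ : Submodule R ↥(maximalIdeal R ^ n))) ≃ₗ[R]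
      (monomialsOfDegree d n →₀ R ⧸ maximalIdeal R) :=
  ((toGradedPiece x n hx).quotKerEquivOfSurjective (toGradedPiece_surjective x n hx)).symm
    ≪≫ₗ Submodule.quotEquivOfEq _ _ (by
      ext c
      rw [mem_ker_toGradedPiece_iff x n hd hx, mem_ker_reduceCoeffs_iff])
    ≪≫ₗ (reduceCoeffs n).quotKerEquivOfSurjective (reduceCoeffs_surjective n)

omit [IsRegularLocalRing R] in
/-- The residue field is a simple `R`-module: `ℓ_R(k) = 1`. [folklore] -/
theorem length_residue [IsLocalRing R] : Module.length R (R ⧸ maximalIdeal R) = 1 := by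
  haveI : IsSimpleModule R (R ⧸ maximalIdeal R) :=
    isSimpleModule_iff_isCoatom.mpr (Ideal.isMaximal_def.mp inferInstance)
  exact Module.length_eq_one _ _

include hd hx in
/-- **CJS Lemma 2.23, the regular case: `ℓ_R(𝔪ⁿ/𝔪ⁿ⁺¹) = binom(n + d - 1, n) = Φ^{(d)}(n)`**
for a regular local ring `R` with regular system of parameters `x_1, …, x_d`
(`d = emb dim R = dim R`). [cite: CossartJannsenSaito2020, Lemma 2.23] -/
theorem length_gradedPiece_of_rsop :
    Module.length R
        (↥(maximalIdeal R ^ n) ⧸ (maximalIdeal R • ⊤ : Submodule R ↥(maximalIdeal R ^ n))) =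
      ((n + d - 1).choose n : ℕ) := by
  rw [(gradedPieceEquivFinsuppQuotient x n hd hx).length_eq, Module.length_finsupp,
    length_residue, mul_one, ENat.card_eq_coe_natCard, card_monomialsOfDegree, Nat.add_comm d n]

omit x in
include hd in
/-- **CJS Lemma 2.23, the regular case**, free of the choice of parameters: for a regular local
ring `R` with `emb dim R = d`, `ℓ_R(𝔪ⁿ/𝔪ⁿ⁺¹) = binom(n + d - 1, n)` for every `n`, i.e.
`H^{(0)}_R = Φ^{(d)}`. [cite: CossartJannsenSaito2020, Lemma 2.23] -/
theorem length_gradedPiece_of_isRegularLocalRing :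
    Module.length R
        (↥(maximalIdeal R ^ n) ⧸ (maximalIdeal R • ⊤ : Submodule R ↥(maximalIdeal R ^ n))) =
      ((n + d - 1).choose n : ℕ) := by
  obtain ⟨x, hx⟩ := exists_regularSystemOfParameters (R := R)
  subst hd
  exact length_gradedPiece_of_rsop x n rfl hx

end Regular

end Literature.RingTheory.HilbertSamuel

end
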